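import Summits.HodgeConjecture.HodgeConjecture.Cruxes.BlochSeedDiscOne.LeggedFloor

/-!
# ROW-α1 — the DERIVED door-(H2) row in its exact first-order form `RuleDSharp`, and `RuleDSharp ⇒ RuleD`
(idea-crit-hsem-3 g23, memo-211 `row-alpha1-ruleD-derived.md`; director-hodge R19.832 (D3) ∕ R19.838 ∕ R19.839 ∕ R19.841 (C))

Token: line stmt-HodgeConjecture-18881 Cruxes/BlochSeedDiscOne/Lines/birth.lean 814a6a70c14e831a stub_rung_pad4_seedAt.

LETTER-MODEL BOOKKEEPING ONLY (`DepthBoundA4.Design`).  Nothing here is a sheaf, a display or a SEED, and nothing here is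
proved toward HC ∕ HC_CM ∕ HC_AV ∕ №4 ∕ 26512 ∕ 18881 ∕ H2.  Evidence-grade file (not a rung); sorry-free; imports the data
model `LeggedFloor` only; no `axiom` ∕ `instance` ∕ `unsafe` ∕ `native_decide`.

## What the pen derivation of memo-211 gives (THEOREM α1, sheaf door, COKERNEL orientation `0 → 𝓟 → 𝓝 → 𝓔 → 0`)
For a split two-term block of letter line bundles on `X = (E₀ × E₀)⁴`, `E₀ = ℂ∕ℤ[i]`, whose cokernel `𝓔` is first-order
unobstructed along the Weil tangent space `T_W` (`ob_κ(𝓔) = κ ∪ At(𝓔) = 0` for all `κ ∈ T_W` — which Buchweitz–Flenner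
I-semiregularity of `𝓔` together with (A1) gives), naturality of the Atiyah class (THEOREM P, memo-151 (iii)) and the Künneth ∕
Mumford–Kempf computation of the supply groups `Ext²(N_y ⊗ γ′, P_x ⊗ γ)` (memo-211 §3, LEMMA S) force, for every supported
cell and every factor pair `g < j`, the SPAN CONDITION

  `B¹(c; g, j), B²(c; g, j) ∈ Σ_{suppliers} A_g ⊗ A_j`     (over `ℚ(i)`)

where `B¹ = [[β_j, a_j − a_g], [0, −β̄_g]]`, `B² = [[−β_g, 0], [a_j − a_g, β̄_j]]` are the two `T_W`-blocks of `ob_κ` of the cell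
(memo-151 (v) ∕ D-MASS §1.2, up to the conjugation convention fixed below; rows = the `dz̄`-index of factor `g`, columns = that of
factor `j`), the sum runs over the supplier cells of the other side (`LeggedFloor.Supplies`: equal off `{g, j}`, equal-or-NULL on
`g`, `j`), and the SUPPLY SPACE of a leg is `A = ℤ[i]²` for an EQUAL leg and the LINE `A = ℤ[i]·(Δa, conj Δβ)` for a NULL step
`Δ = (Δa; Δβ)` (the pull-back line `π_Δ^* H¹(B_Δ, 𝒪)` of the elliptic fibration the null class defines).  Convention: a letter
`(a; β)`, `β = x + iy`, is the hermitian form `[[a, β̄], [β, a]]` on the factor `ℂ²` (so `β̄` sits on `e = dz₁ ∧ dz̄₂`, as in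
`DepthBoundA4`); `κ ⌟ ω_H = Kᵀ H − Hᵀ K`.

`RuleDSharp` below is exactly this span condition, written over `ℤ[i]` with a cleared denominator (`d • B = Σ …`, `d ≠ 0`), as a
`Prop` with no decidability instances.  It refines the presence shadow `LeggedFloor.RuleD` (`ruleD_of_ruleDSharp`) STRICTLY
(`ruleD_DLeg`, `not_ruleDSharp_DLeg`: memo-152's legged pair passes RULE D and fails the span condition).  The KERNEL orientation
`0 → 𝓔 → 𝓝 → 𝓟 → 0` yields the same row for the SWAPPED design (`RuleDK`, §3): null steps reversed.

Honest ledger: the implication «passing split-block SHEAF datum ⇒ `RuleDSharp (shadow)`» is PEN (memo-211 §4), not kernel — the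
tree's `IsISemiregular` interface carries no Atiyah class; this file is the letter-side target and its elementary consequences.
-/

set_option linter.dupNamespace false
set_option autoImplicit false

namespace Summit.HodgeConjecture.HodgeConjecture.Cruxes.BlochSeedDiscOne.RowAlpha1

open Summit.HodgeConjecture.HodgeConjecture.Cruxes.BlochSeedDiscOne.DepthBoundA4
open Summit.HodgeConjecture.HodgeConjecture.Cruxes.BlochSeedDiscOne.LeggedFloor

/-! ## §1 Blocks, supply spaces, the span condition -/

/-- `2 × 2` matrices over `ℤ[i]` (rows: the `dz̄`-index of factor `g`; columns: that of factor `j`). -/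
abbrev Mat : Type := Fin 2 → Fin 2 → GaussianInt

/-- column vectors over `ℤ[i]`. -/
abbrev Vec : Type := Fin 2 → GaussianInt

/-- an integer as a Gaussian integer. -/
def zi (n : ℤ) : GaussianInt := ⟨n, 0⟩

/-- the first `T_W`-block of `ob_κ` of the cell `c` at the factor pair `(g, j)` (coefficient of the parameter `p_{gj}`):
`[[β_j, a_j − a_g], [0, −β̄_g]]`. -/
def B1 (c : Cell) (g j : Fin 4) : Mat :=
  ![![(c j).beta, zi ((c j).a - (c g).a)], ![0, -star (c g).beta]]

/-- the second `T_W`-block (coefficient of `q_{gj}`): `[[−β_g, 0], [a_j − a_g, β̄_j]]`. -/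
def B2 (c : Cell) (g j : Fin 4) : Mat :=
  ![![-(c g).beta, 0], ![zi ((c j).a - (c g).a), star (c j).beta]]

/-- the supply LINE of a null step `ℓ → ℓ′`, `Δ = ℓ′ − ℓ`: the vector `(Δa, conj Δβ)`. -/
def nullLine (ℓ ℓ' : Letter) : Vec := ![zi (ℓ'.a - ℓ.a), star (ℓ'.beta - ℓ.beta)]

/-- `u` lies in the SUPPLY SPACE of the leg `ℓP → ℓN`: anything on an EQUAL leg, a `ℤ[i]`-multiple of the null line otherwise
(on a supplier pair the non-equal legs are null steps, `LeggedFloor.Supplies`). -/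
def InLeg (ℓP ℓN : Letter) (u : Vec) : Prop := ℓP = ℓN ∨ ∃ t : GaussianInt, u = t • nullLine ℓP ℓN

/-- outer product `u vᵀ`. -/
def outer (u v : Vec) : Mat := fun r s => u r * v s

/-- `M` is an ELEMENTARY SUPPLY of the pair (P-cell `x`, N-cell `y`) at `(g, j)`: `M = u vᵀ` with `u` in the supply space of leg
`g` and `v` in that of leg `j`. -/
def ElemSupply (x y : Cell) (g j : Fin 4) (M : Mat) : Prop :=
  ∃ u v : Vec, InLeg (x g) (y g) u ∧ InLeg (x j) (y j) v ∧ M = outer u v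

/-- `B` lies in the `ℚ(i)`-span of the supplies offered to the N-cell `y` at `(g, j)` by the supported P-cells: a non-zero
`ℤ[i]`-multiple of `B` is a finite sum of elementary supplies of supplier pairs `(x, y)`, `x ∈ suppP`. -/
def SuppliedN (D : Design) (y : Cell) (g j : Fin 4) (B : Mat) : Prop :=
  ∃ d : GaussianInt, d ≠ 0 ∧ ∃ S : List (Cell × Mat),
    (∀ p ∈ S, p.1 ∈ D.suppP ∧ Supplies p.1 y g j ∧ ElemSupply p.1 y g j p.2) ∧ d • B = (S.map Prod.snd).sum

/-- the same on the P side: supplies offered to the P-cell `x` by the supported N-cells. -/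
def SuppliedP (D : Design) (x : Cell) (g j : Fin 4) (B : Mat) : Prop :=
  ∃ d : GaussianInt, d ≠ 0 ∧ ∃ S : List (Cell × Mat),
    (∀ p ∈ S, p.1 ∈ D.suppN ∧ Supplies x p.1 g j ∧ ElemSupply x p.1 g j p.2) ∧ d • B = (S.map Prod.snd).sum

/-- **`RuleDSharp`, THE DERIVED ROW (exact first-order form of door (H2), cokernel orientation)**: both `T_W`-blocks of every
supported cell at every factor pair `g < j` are supplied (span condition over `ℚ(i)`), on both sides. -/
def RuleDSharp (D : Design) : Prop :=
  (∀ y ∈ D.suppN, ∀ g j : Fin 4, g < j → SuppliedN D y g j (B1 y g j) ∧ SuppliedN D y g j (B2 y g j)) ∧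
  (∀ x ∈ D.suppP, ∀ g j : Fin 4, g < j → SuppliedP D x g j (B1 x g j) ∧ SuppliedP D x g j (B2 x g j))

/-! ## §2 `Detects` is «`B¹ ≠ 0`», and the span condition implies RULE D -/

theorem zi_eq_zero_iff (n : ℤ) : zi n = 0 ↔ n = 0 := by
  constructor
  · intro h
    have := congrArg Zsqrtd.re h
    simpa [zi] using this
  · intro h
    subst h
    rfl

theorem beta_eq_zero_iff (ℓ : Letter) : ℓ.beta = 0 ↔ ℓ.x = 0 ∧ ℓ.y = 0 := by
  constructor
  · intro h
    exact ⟨by simpa [Letter.beta] using congrArg Zsqrtd.re h, by simpa [Letter.beta] using congrArg Zsqrtd.im h⟩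
  · rintro ⟨hx, hy⟩
    simp [Letter.beta, hx, hy]
    rfl

/-- the first block vanishes exactly on NON-detecting pairs (`β_g = β_j = 0`, `a_g = a_j`). -/
theorem B1_eq_zero_iff (c : Cell) (g j : Fin 4) : B1 c g j = 0 ↔ ¬ Detects c g j := by
  unfold Detects
  push Not
  constructor
  · intro h
    have h00 : (c j).beta = 0 := by simpa [B1] using congrFun (congrFun h 0) 0
    have h01 : zi ((c j).a - (c g).a) = 0 := by simpa [B1] using congrFun (congrFun h 0) 1
    have h11 : -star (c g).beta = 0 := by simpa [B1] using congrFun (congrFun h 1) 1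
    have hg : (c g).beta = 0 := by
      have : star (c g).beta = 0 := neg_eq_zero.mp h11
      simpa using congrArg star this
    obtain ⟨hjx, hjy⟩ := (beta_eq_zero_iff _).mp h00
    obtain ⟨hgx, hgy⟩ := (beta_eq_zero_iff _).mp hg
    have ha : (c j).a - (c g).a = 0 := (zi_eq_zero_iff _).mp h01
    exact ⟨hgx, hgy, hjx, hjy, by omega⟩
  · rintro ⟨hgx, hgy, hjx, hjy, ha⟩
    have hg : (c g).beta = 0 := (beta_eq_zero_iff _).mpr ⟨hgx, hgy⟩
    have hj : (c j).beta = 0 := (beta_eq_zero_iff _).mpr ⟨hjx, hjy⟩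
    have hz : zi ((c j).a - (c g).a) = 0 := (zi_eq_zero_iff _).mpr (by omega)
    funext r s
    fin_cases r <;> fin_cases s <;> simp [B1, hg, hj, hz]

/-- likewise for the second block. -/
theorem B2_eq_zero_iff (c : Cell) (g j : Fin 4) : B2 c g j = 0 ↔ ¬ Detects c g j := by
  unfold Detects
  push Not
  constructor
  · intro h
    have h00 : -(c g).beta = 0 := by simpa [B2] using congrFun (congrFun h 0) 0
    have h10 : zi ((c j).a - (c g).a) = 0 := by simpa [B2] using congrFun (congrFun h 1) 0
    have h11 : star (c j).beta = 0 := by simpa [B2] using congrFun (congrFun h 1) 1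
    have hg : (c g).beta = 0 := neg_eq_zero.mp h00
    have hj : (c j).beta = 0 := by simpa using congrArg star h11
    obtain ⟨hjx, hjy⟩ := (beta_eq_zero_iff _).mp hj
    obtain ⟨hgx, hgy⟩ := (beta_eq_zero_iff _).mp hg
    have ha : (c j).a - (c g).a = 0 := (zi_eq_zero_iff _).mp h10
    exact ⟨hgx, hgy, hjx, hjy, by omega⟩
  · rintro ⟨hgx, hgy, hjx, hjy, ha⟩
    have hg : (c g).beta = 0 := (beta_eq_zero_iff _).mpr ⟨hgx, hgy⟩
    have hj : (c j).beta = 0 := (beta_eq_zero_iff _).mpr ⟨hjx, hjy⟩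
    have hz : zi ((c j).a - (c g).a) = 0 := (zi_eq_zero_iff _).mpr (by omega)
    funext r s
    fin_cases r <;> fin_cases s <;> simp [B2, hg, hj, hz]

/-- a detecting block that is supplied (N side) HAS a supplier cell. -/
theorem exists_supplier_of_suppliedN (D : Design) (y : Cell) (g j : Fin 4) {B : Mat} (hB : B ≠ 0)
    (h : SuppliedN D y g j B) : ∃ x ∈ D.suppP, Supplies x y g j := by
  obtain ⟨d, hd, S, hS, hsum⟩ := h
  match S, hS, hsum with
  | [], _, hsum =>
    exfalso
    have : d • B = 0 := by simpa using hsum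
    rcases smul_eq_zero.mp this with h0 | h0
    · exact hd h0
    · exact hB h0
  | p :: _, hS, _ =>
    exact ⟨p.1, (hS p (by simp)).1, (hS p (by simp)).2.1⟩

/-- … and on the P side. -/
theorem exists_supplier_of_suppliedP (D : Design) (x : Cell) (g j : Fin 4) {B : Mat} (hB : B ≠ 0)
    (h : SuppliedP D x g j B) : ∃ y ∈ D.suppN, Supplies x y g j := by
  obtain ⟨d, hd, S, hS, hsum⟩ := h
  match S, hS, hsum with
  | [], _, hsum =>
    exfalso
    have : d • B = 0 := by simpa using hsum
    rcases smul_eq_zero.mp this with h0 | h0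
    · exact hd h0
    · exact hB h0
  | p :: _, hS, _ =>
    exact ⟨p.1, (hS p (by simp)).1, (hS p (by simp)).2.1⟩

/-- **THE DERIVED ROW IMPLIES RULE D** (presence shadow): `RuleDSharp D → LeggedFloor.RuleD D`. -/
theorem ruleD_of_ruleDSharp (D : Design) (h : RuleDSharp D) : RuleD D := by
  refine ⟨fun y hy g j hgj hdet => ?_, fun x hx g j hgj hdet => ?_⟩
  · have hB : B1 y g j ≠ 0 := fun h0 => ((B1_eq_zero_iff y g j).mp h0) hdet
    exact exists_supplier_of_suppliedN D y g j hB (h.1 y hy g j hgj).1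
  · have hB : B1 x g j ≠ 0 := fun h0 => ((B1_eq_zero_iff x g j).mp h0) hdet
    exact exists_supplier_of_suppliedP D x g j hB (h.2 x hx g j hgj).1

/-! ## §3 Orientation: the KERNEL presentation `0 → 𝓔 → 𝓝 → 𝓟 → 0` reads the row on the SWAPPED design
There the block map goes `L_N → L_P`, a non-zero entry needs `P − N` weakly effective, the supply groups are
`Ext²(P_x, N_y) = H²(N_y − P_x)`, and LEMMA S returns the same supply spaces with every NULL STEP REVERSED (`N → P`): the derived
row is the cokernel row of `D.swap`. -/

/-- exchange the two sides of a design. -/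
def swap (D : Design) : Design := ⟨D.P, D.N⟩

theorem suppN_swap (D : Design) : (swap D).suppN = D.suppP := rfl
theorem suppP_swap (D : Design) : (swap D).suppP = D.suppN := rfl
theorem swap_swap (D : Design) : swap (swap D) = D := rfl

/-- **the derived presence row for KERNEL-presented blocks**: RULE D of the swapped design. -/
def RuleDK (D : Design) : Prop := RuleD (swap D)

/-- **the derived exact row for KERNEL-presented blocks.** -/
def RuleDSharpK (D : Design) : Prop := RuleDSharp (swap D)

theorem ruleDK_of_ruleDSharpK (D : Design) (h : RuleDSharpK D) : RuleDK D := ruleD_of_ruleDSharp _ h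

/-- `RuleDK` unfolded: every detecting block of a supported P-cell `x` is supplied by a supported N-cell `y` through legs that are
EQUAL or NULL STEPS `y → x` (N below P), and symmetrically — i.e. RULE D with the roles of the two supports exchanged. -/
theorem ruleDK_iff (D : Design) : RuleDK D ↔
    (∀ x ∈ D.suppP, ∀ g j : Fin 4, g < j → Detects x g j → ∃ y ∈ D.suppN, Supplies y x g j) ∧
    (∀ y ∈ D.suppN, ∀ g j : Fin 4, g < j → Detects y g j → ∃ x ∈ D.suppP, Supplies y x g j) := Iff.rfl

/-! ## §4 Strictness: memo-152's LEGGED PAIR passes RULE D and fails the derived row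
`x = ((0; 4+5i), hub, hub, hub) → y = ((4; 4+i), hub, hub, hub)`, hub `= (14; 0)`: factor `0` is a NULL step (`Δ = (4; −4i)`),
factors `1, 2, 3` are EQUAL.  Only the blocks `(0, j)` detect, and the pair supplies each of them, so `RuleD` holds on both sides.
At the block `(0, 1)` of `y` the supply space is `ℓ ⊗ ℤ[i]²`, `ℓ = (4, 4i)` (matrices whose columns are multiples of `ℓ`), while
`B¹(y; 0, 1) = [[0, 10], [0, −(4 − i)]]` has second column `(10, −4 + i) ∉ ℚ(i)·ℓ`; the functional `Λ = [[0, 1], [0, i]]` kills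
every supply and pairs to `10 + i·(−4 + i) = 9 − 4i ≠ 0` with `B¹` — so `RuleDSharp` fails. -/

/-- the pairing `⟨Λ, M⟩ = Σ Λ_rs M_rs`. -/
def pairing (Λ M : Mat) : GaussianInt := ∑ r, ∑ s, Λ r s * M r s

theorem pairing_add (Λ M M' : Mat) : pairing Λ (M + M') = pairing Λ M + pairing Λ M' := by
  simp only [pairing, Pi.add_apply, mul_add, Finset.sum_add_distrib]

theorem pairing_zero (Λ : Mat) : pairing Λ 0 = 0 := by simp [pairing]

theorem pairing_smul (Λ : Mat) (d : GaussianInt) (M : Mat) : pairing Λ (d • M) = d * pairing Λ M := by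
  simp only [pairing, Pi.smul_apply, smul_eq_mul, Finset.mul_sum]
  refine Finset.sum_congr rfl fun r _ => Finset.sum_congr rfl fun s _ => by ring

theorem pairing_list_sum (Λ : Mat) (L : List Mat) : pairing Λ L.sum = (L.map (pairing Λ)).sum := by
  induction L with
  | nil => simp [pairing_zero]
  | cons M L ih => simp [pairing_add, ih]

theorem pairing_outer (Λ : Mat) (u v : Vec) :
    pairing Λ (outer u v) = ∑ r, ∑ s, Λ r s * (u r * v s) := rfl

/-- **FUNCTIONAL CERTIFICATE of non-supply (N side)**: a functional vanishing on every elementary supply of every supplier of `y`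
at `(g, j)` and non-zero on `B` refutes `SuppliedN`. -/
theorem not_suppliedN_of_functional (D : Design) (y : Cell) (g j : Fin 4) (B Λ : Mat)
    (h0 : ∀ x ∈ D.suppP, Supplies x y g j → ∀ M, ElemSupply x y g j M → pairing Λ M = 0) (h1 : pairing Λ B ≠ 0) :
    ¬ SuppliedN D y g j B := by
  rintro ⟨d, hd, S, hS, hsum⟩
  have hall : ∀ p ∈ S, pairing Λ p.2 = 0 := fun p hp => h0 p.1 (hS p hp).1 (hS p hp).2.1 p.2 (hS p hp).2.2
  have hzero : pairing Λ (S.map Prod.snd).sum = 0 := by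
    rw [pairing_list_sum]
    refine List.sum_eq_zero fun w hw => ?_
    obtain ⟨M, hM, rfl⟩ := List.mem_map.mp hw
    obtain ⟨p, hp, rfl⟩ := List.mem_map.mp hM
    exact hall p hp
  have : d * pairing Λ B = 0 := by rw [← pairing_smul, hsum, hzero]
  rcases mul_eq_zero.mp this with h | h
  · exact hd h
  · exact h1 h

/-- the same certificate on the P side. -/
theorem not_suppliedP_of_functional (D : Design) (x : Cell) (g j : Fin 4) (B Λ : Mat)
    (h0 : ∀ y ∈ D.suppN, Supplies x y g j → ∀ M, ElemSupply x y g j M → pairing Λ M = 0) (h1 : pairing Λ B ≠ 0) :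
    ¬ SuppliedP D x g j B := by
  rintro ⟨d, hd, S, hS, hsum⟩
  have hall : ∀ p ∈ S, pairing Λ p.2 = 0 := fun p hp => h0 p.1 (hS p hp).1 (hS p hp).2.1 p.2 (hS p hp).2.2
  have hzero : pairing Λ (S.map Prod.snd).sum = 0 := by
    rw [pairing_list_sum]
    refine List.sum_eq_zero fun w hw => ?_
    obtain ⟨M, hM, rfl⟩ := List.mem_map.mp hw
    obtain ⟨p, hp, rfl⟩ := List.mem_map.mp hM
    exact hall p hp
  have : d * pairing Λ B = 0 := by rw [← pairing_smul, hsum, hzero]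
  rcases mul_eq_zero.mp this with h | h
  · exact hd h
  · exact h1 h

/-- the P-cell of the legged pair. -/
def xLeg : Cell := ![⟨0, 4, 5⟩, Letter.hub 14, Letter.hub 14, Letter.hub 14]

/-- the N-cell of the legged pair. -/
def yLeg : Cell := ![⟨4, 4, 1⟩, Letter.hub 14, Letter.hub 14, Letter.hub 14]

/-- the one-arrow legged design `xLeg → yLeg`, multiplicities `1`. -/
def DLeg : Design := ⟨[(yLeg, 1)], [(xLeg, 1)]⟩

theorem suppN_DLeg : DLeg.suppN = [yLeg] := by decide
theorem suppP_DLeg : DLeg.suppP = [xLeg] := by decide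

/-- the pair is a supplier pair for every block through factor `0` (null step there, equal elsewhere) … -/
theorem supplies_leg (j : Fin 4) (hj : 0 < j) : Supplies xLeg yLeg 0 j := by
  fin_cases j
  · exact absurd hj (by decide)
  all_goals (unfold Supplies NullStep xLeg yLeg; decide)

/-- … the blocks avoiding factor `0` do not detect (hub letters on factors `1, 2, 3`): a detecting block of `xLeg` … -/
theorem detects_xLeg_imp (g j : Fin 4) (hgj : g < j) (h : Detects xLeg g j) : g = 0 := by
  fin_cases g <;> fin_cases j <;>
    first | decide | exact absurd hgj (by decide) | exact absurd h (by unfold Detects xLeg; decide)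

/-- … or of `yLeg` passes through factor `0` … -/
theorem detects_yLeg_imp (g j : Fin 4) (hgj : g < j) (h : Detects yLeg g j) : g = 0 := by
  fin_cases g <;> fin_cases j <;>
    first | decide | exact absurd hgj (by decide) | exact absurd h (by unfold Detects yLeg; decide)

/-- **… so the legged design passes RULE D.** -/
theorem ruleD_DLeg : RuleD DLeg := by
  refine ⟨fun y hy g j hgj hdet => ?_, fun x hx g j hgj hdet => ?_⟩
  · rw [suppN_DLeg, List.mem_singleton] at hy
    subst hy
    have hg := detects_yLeg_imp g j hgj hdet
    subst hg
    exact ⟨xLeg, by rw [suppP_DLeg]; simp, supplies_leg j hgj⟩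
  · rw [suppP_DLeg, List.mem_singleton] at hx
    subst hx
    have hg := detects_xLeg_imp g j hgj hdet
    subst hg
    exact ⟨yLeg, by rw [suppN_DLeg]; simp, supplies_leg j hgj⟩

/-- the certificate functional at the block `(0, 1)`: `Λ = [[0, 1], [0, i]]`. -/
def LamLeg : Mat := ![![0, 1], ![0, ⟨0, 1⟩]]

/-- `Λ` kills every elementary supply of the pair at `(0, 1)`: those are `u vᵀ` with `u = t • (4, 4i)` (null leg `0`; the letters
there are NOT equal) and `v` arbitrary (equal leg `1`), and `ℓᵀ Λ = 0` for `ℓ = (4, 4i)`. -/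
theorem lamLeg_kills (M : Mat) (hM : ElemSupply xLeg yLeg 0 1 M) : pairing LamLeg M = 0 := by
  obtain ⟨u, v, hu, _, rfl⟩ := hM
  rcases hu with heq | ⟨t, rfl⟩
  · exact absurd heq (by unfold xLeg yLeg; decide)
  · have hl : nullLine (xLeg 0) (yLeg 0) = ![⟨4, 0⟩, ⟨0, 4⟩] := by
      unfold nullLine xLeg yLeg; decide
    rw [hl, pairing_outer]
    simp only [Fin.sum_univ_two, LamLeg, Pi.smul_apply, smul_eq_mul, Matrix.cons_val_zero, Matrix.cons_val_one]
    -- `0·(…) + 1·(4t·v₁) + 0·(…) + i·(4i·t·v₁)` = `t·v₁·(4 + i·4i)` = 0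
    have key : (⟨4, 0⟩ : GaussianInt) + ⟨0, 1⟩ * ⟨0, 4⟩ = 0 := by decide
    linear_combination (t * v 1) * key

/-- `Λ` pairs non-trivially with `B¹(yLeg; 0, 1) = [[0, 10], [0, −(4 − i)]]`: the value is `10 + i·(−4 + i) = 9 − 4i`. -/
theorem lamLeg_B1 : pairing LamLeg (B1 yLeg 0 1) = ⟨9, -4⟩ := by
  unfold pairing LamLeg B1 yLeg zi
  decide

/-- **… so the legged design FAILS the derived row** (N side, block `(0, 1)`, first block). -/
theorem not_ruleDSharp_DLeg : ¬ RuleDSharp DLeg := by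
  intro h
  have h01 := (h.1 yLeg (by rw [suppN_DLeg]; simp) 0 1 (by decide)).1
  refine not_suppliedN_of_functional DLeg yLeg 0 1 (B1 yLeg 0 1) LamLeg ?_ ?_ h01
  · intro x hx _ M hM
    rw [suppP_DLeg, List.mem_singleton] at hx
    subst hx
    exact lamLeg_kills M hM
  · rw [lamLeg_B1]; decide

/-- **RULE D is STRICTLY weaker than the derived row.** -/
theorem ruleDSharp_strictly_stronger : ∃ D : Design, RuleD D ∧ ¬ RuleDSharp D := ⟨DLeg, ruleD_DLeg, not_ruleDSharp_DLeg⟩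

/-! ## §5 Frame form of the blocks on μ₄-ADAPTED legs — the PAIR-IMAGE dictionary of PAD4-BALANCED §1′, kernel
(v1.1 of this file; director R19.858 (O6)(c) «the one plate hsem-3 did not do»)

PAD4-BALANCED §1′ ∕ `Summits/Ventures/HSemireg/Pad4TowerRuleDMu4.lean`: on a factor, a letter `(a; b·ζ)` ADAPTED to the frame of the
null phase `ζ` (`ζ ∈ μ₄` there; here any `ζ` with `ζ·ζ̄ = 1`) has the two FRAME COORDINATES `c_{±}` with `2c_ε = C^ε := a + ε b`
(`Pad4Tower.coord`, doubled), and the two null lines of the frame are `u_ε(ζ) = (1, ε ζ̄)` (`u_{+1} = ξ̄_ζ`, `u_{−1} = ξ̄_{−ζ}`), a basis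
of the factor's `H^{0,1}`.  THE DICTIONARY (kernel below): in the basis `u_ε(ζ) ⊗ u_{ε′}(ζ′)` of the `(g, j)` block space, the
coefficient of `B¹(y; g, j)` at `(ε, ε′)` is `ζ′·ε′·(C_j^{ε′} − C_g^{ε})∕4` and that of `B²` is `ζ·ε·(C_j^{ε′} − C_g^{ε})∕4` — a UNIT
times the DIFFERENCE OF FRAME COORDINATES.  CONSEQUENCE (pen, 6 lines, memo-211 NOTE-12): on a 𝔅(μ₄) configuration (every letter
μ₄-phased or apex) with `Disj`, every supplier's null legs at a NON-apex adapted factor run IN the frame directions, so the supply space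
`Σ` of §1 is a COORDINATE subspace in the frame bases — it contains `u_ε ⊗ u_{ε′}` iff `(g, ε)` is served, or `(j, ε′)` is served, or an
(r2a) cover moves exactly `{(g,ε), (j,ε′)}` — and `B¹, B² ∈ Σ` reads: «every pair of frame coordinates with `C_j^{ε′} ≠ C_g^{ε}` is
served on one side or covered», i.e. `Pad4Tower.RuleDMu4N` (resp. `RuleDMu4P`) clause by clause; at APEX factors (`b = 0`, rows of
`B¹` equal) served in an off-frame direction `r`, the frame containing `r` gives the same reading (`SettledBelow`'s «`r ≠ k + 2`»).
Hence **`RuleDSharp ⇒ RuleDMu4N ∧ RuleDMu4P` on 𝔅(μ₄) configurations with `Disj`** (pen); the converse fails only where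
`Pad4TowerRuleDMu4` FLAG F-1 is deliberately permissive (an UNSERVED apex factor «resolved» by a single off-frame cover: `ξ̄_a ⊗ v`
alone never contains `ē_A ⊗ v`).  SANDWICH: exact first-order criterion (PAD4-LEAK (0.3), `ruleD_dead_fast.py`) ⇒ `RuleDSharp` ⇒
`RuleDMu4N ∧ RuleDMu4P` (fine law); the cell found the two ends equal orbit for orbit on its census universes (`Pad4TowerRuleDMu4` (i)),
so THERE ROW α1♯ = the fine law = the exact test and re-closes nothing new, and elsewhere α1♯ can part from the fine law only at FLAG F-1
spots (siding with the exact test).  What ROW-α1 adds is the LICENCE: every fine-law ∕ `ruleD_dead_fast` kill is, via this dictionary and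
memo-211 THEOREM α1, a DERIVED kill for the sheaf door. -/

/-- `zi` is the integer cast. -/
theorem zi_eq_intCast (n : ℤ) : zi n = (n : GaussianInt) := by
  ext <;> simp [zi]

/-- the frame vector `u_ε(ζ) = (1, ε·ζ̄)` of the null phase `ζ` with sign `ε` (meant for `ε = ±1`). -/
def frameVec (ζ : GaussianInt) (ε : ℤ) : Vec := ![1, zi ε * star ζ]

/-- twice the frame coordinate `c_ε` of an adapted letter `(a; b·ζ)`: `C^ε = a + ε·b` (`Pad4Tower.coord`). -/
def frameCoord (a b ε : ℤ) : ℤ := a + ε * b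

/-- a null step of phase `ζ` and length `d` (`Δa = d`, `Δβ = d·ζ`) supplies exactly the frame line `u_{+1}(ζ) = ξ̄_ζ`:
`nullLine = d • u_{+1}(ζ)` (memo-211 §3 (iv) ↔ the cell's `Ξ_ζ = ℂ·ξ̄_ζ`). -/
theorem nullLine_of_phase (ℓ ℓ' : Letter) (ζ : GaussianInt) (d : ℤ) (ha : ℓ'.a - ℓ.a = d) (hb : ℓ'.beta - ℓ.beta = zi d * ζ) :
    nullLine ℓ ℓ' = zi d • frameVec ζ 1 := by
  funext r
  fin_cases r
  · simp [nullLine, frameVec, ha]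
  · simp [nullLine, frameVec, hb, zi_eq_intCast, star_mul']

/-- **FRAME FORM OF `B¹`** (PAIR-IMAGE dictionary, first block): legs `g`, `j` of `y` adapted with `β_g = b_g ζ`, `β_j = b_j ζ′`,
`ζ′ζ̄′ = 1` ⇒ `4·B¹ = ζ′ · Σ_{ε,ε′} ε′ (C_j^{ε′} − C_g^{ε}) · u_ε(ζ) ⊗ u_{ε′}(ζ′)`: the `(ε, ε′)` frame coefficient of `B¹` is
`ζ′ε′∕4` times the difference of (doubled) frame coordinates `C_j^{ε′} − C_g^{ε}`. -/
theorem B1_frame (y : Cell) (g j : Fin 4) (ζ ζ' : GaussianInt) (hζ' : ζ' * star ζ' = 1) (bg bj : ℤ)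
    (hg : (y g).beta = zi bg * ζ) (hj : (y j).beta = zi bj * ζ') :
    (4 : GaussianInt) • B1 y g j = ζ' • (
        zi (frameCoord (y j).a bj 1 - frameCoord (y g).a bg 1) • outer (frameVec ζ 1) (frameVec ζ' 1)
      - zi (frameCoord (y j).a bj (-1) - frameCoord (y g).a bg 1) • outer (frameVec ζ 1) (frameVec ζ' (-1))
      + zi (frameCoord (y j).a bj 1 - frameCoord (y g).a bg (-1)) • outer (frameVec ζ (-1)) (frameVec ζ' 1)
      - zi (frameCoord (y j).a bj (-1) - frameCoord (y g).a bg (-1)) • outer (frameVec ζ (-1)) (frameVec ζ' (-1))) := by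
  funext r c
  fin_cases r <;> fin_cases c <;>
    simp [B1, outer, frameVec, frameCoord, zi_eq_intCast, hg, hj, star_mul', Pi.smul_apply, smul_eq_mul]
  · ring
  · linear_combination (-4 * (((y j).a : GaussianInt) - ((y g).a : GaussianInt))) * hζ'
  · exact Or.inr (by ring)
  · linear_combination (4 * (bg : GaussianInt) * star ζ) * hζ'

/-- **FRAME FORM OF `B²`** (second block, `ζζ̄ = 1`): `4·B² = ζ · Σ_{ε,ε′} ε (C_j^{ε′} − C_g^{ε}) · u_ε(ζ) ⊗ u_{ε′}(ζ′)`. -/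
theorem B2_frame (y : Cell) (g j : Fin 4) (ζ ζ' : GaussianInt) (hζ : ζ * star ζ = 1) (bg bj : ℤ)
    (hg : (y g).beta = zi bg * ζ) (hj : (y j).beta = zi bj * ζ') :
    (4 : GaussianInt) • B2 y g j = ζ • (
        zi (frameCoord (y j).a bj 1 - frameCoord (y g).a bg 1) • outer (frameVec ζ 1) (frameVec ζ' 1)
      + zi (frameCoord (y j).a bj (-1) - frameCoord (y g).a bg 1) • outer (frameVec ζ 1) (frameVec ζ' (-1))
      - zi (frameCoord (y j).a bj 1 - frameCoord (y g).a bg (-1)) • outer (frameVec ζ (-1)) (frameVec ζ' 1)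
      - zi (frameCoord (y j).a bj (-1) - frameCoord (y g).a bg (-1)) • outer (frameVec ζ (-1)) (frameVec ζ' (-1))) := by
  funext r c
  fin_cases r <;> fin_cases c <;>
    simp [B2, outer, frameVec, frameCoord, zi_eq_intCast, hg, hj, star_mul', Pi.smul_apply, smul_eq_mul]
  · ring
  · exact Or.inr (by ring)
  · linear_combination (-4 * (((y j).a : GaussianInt) - ((y g).a : GaussianInt))) * hζ
  · linear_combination (-4 * (bj : GaussianInt) * star ζ') * hζ

end Summit.HodgeConjecture.HodgeConjecture.Cruxes.BlochSeedDiscOne.RowAlpha1
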